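import Mathlib
import Literature.Analysis.UnboundedOperators.ConjugateOperatorRegularity
import HarnessLib
import Summits.AtomisticToContinuum.FouriersLaw.Theorems.EmbeddedDrudeMourreMourreDissolutionLAPQuadraticEstimate

/-!
# Stub `stub_mourreThresholdLAP` — F5: the uniform Cauchy property from Mourre's `ε`-integration

Item `stmt-AtomisticToContinuum-12594` (crux `MourreDissolution` of route `EmbeddedDrudeMourre`,
sub-problem `FouriersLaw`), line `separable-vertex-faddeev-pair-sector`, stub S6
`stub_mourreThresholdLAP` (Mourre's limiting absorption principle, `C²` form), helper F5 of the
proof map (Mourre 1981; ABG = Amrein–Boutet de Monvel–Georgescu 1996, end of the proof of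
Thm. 7.3.1, eqs. (7.3.12)–(7.3.13)), in ABSTRACT form: the `ε`-integration of Mourre's
differential inequality, decoupled from the differential inequality itself.

Setting (notation of `…LAPDissipativeResolvent{,Identities,Deriv}`): `U(t) = e^{itH}`,
`R(z) = resolventAt U z`, a bounded dissipative `M` (`0 ≤ Re ⟪f, M f⟫`),
`G_ε(z) = mourreG U M ε z` ("`(H - z + iεM)⁻¹`"), a vector `f`, and for `z = ω - iν`
Mourre's function `F_ε(z) = ⟪f, G_ε(z) f⟫` with `d/dε F_ε(z) = -i ⟪f, G_ε(z) M G_ε(z) f⟫`.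

HYPOTHESES (the output of the differential-inequality step F4, uniformly in `ω ∈ S`,
`ν ∈ (0, 1]`): a norm bound `‖G_ε(ω - iν)‖ ≤ C/ε` on `(0, ε₀]` and a derivative bound
`‖⟪f, G_ε M G_ε f⟫‖ ≤ κ(ε)` on `(0, ε₀)` with `κ` integrable on `(0, ε₀]`.

* §1 the fundamental theorem of calculus in `ε` at fixed `z`:
  `⟪f, R(z) f⟫ = F_{ε₀}(z) + i ∫₀^{ε₀} ⟪f, G_ε M G_ε f⟫ dε`;
* §2 Lipschitz bounds in `z` at fixed `ε > 0`: `‖F_ε(z₁) - F_ε(z₂)‖ ≤ ‖f‖² |z₁ - z₂| (C/ε)²` and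
  `‖F'_ε(z₁) - F'_ε(z₂)‖ ≤ 2 ‖f‖² ‖M‖ |z₁ - z₂| (C/ε)³`;
* §3 CONCLUSION: `ν ↦ (ω ↦ ⟪f, R(ω - iν) f⟫)` is uniformly Cauchy on `S` as `ν ↓ 0` (split
  `∫₀^{ε₀} = ∫₀^{s} + ∫_s^{ε₀}`, the first piece `≤ 2∫₀^s κ` small by integrability, the second
  Lipschitz in `ν`), hence so is the Laplace–Fourier transform
  `laplaceFourier U f ν ω = i ⟪f, R(ω - iν) f⟫`; headline `laplaceFourier_uniformCauchy_of_bounds`.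
-/

noncomputable section

open MeasureTheory Complex Filter Topology Set intervalIntegral
open scoped InnerProductSpace ComplexConjugate ENNReal NNReal

namespace Summit.AtomisticToContinuum.FouriersLaw.Theorems.MourreDissolution

open Literature.Analysis.UnboundedOperators
open Literature.Analysis.UnboundedOperators.UnitaryRep

variable {H : Type*} [NormedAddCommGroup H] [InnerProductSpace ℂ H] [CompleteSpace H]

/-! ## §1. The fundamental theorem of calculus in `ε` -/

/-- `ε ↦ ⟪f, G_ε(z) g⟫` is continuous on `[0, ∞)` for `Im z < 0`. [folklore] -/
theorem continuousOn_inner_mourreG_Ici {M : H →L[ℂ] H} (hM : ∀ f : H, 0 ≤ (⟪f, M f⟫_ℂ).re)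
    {z : ℂ} (hz : z.im < 0) (U : OneParameterUnitaryGroup H) (f g : H) :
    ContinuousOn (fun ε : ℝ => ⟪f, mourreG U M ε z g⟫_ℂ) (Set.Ici 0) :=
  continuousOn_const.inner ((continuousOn_mourreG_Ici hM hz U).clm_apply continuousOn_const)

/-- `ε ↦ ⟪f, G_ε(z) M G_ε(z) g⟫` is continuous on `[0, ∞)` for `Im z < 0`. [folklore] -/
theorem continuousOn_inner_mourreG_mul_mul_Ici {M : H →L[ℂ] H} (hM : ∀ f : H, 0 ≤ (⟪f, M f⟫_ℂ).re)
    {z : ℂ} (hz : z.im < 0) (U : OneParameterUnitaryGroup H) (f g : H) :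
    ContinuousOn (fun ε : ℝ => ⟪f, mourreG U M ε z (M (mourreG U M ε z g))⟫_ℂ) (Set.Ici 0) := by
  have hG := continuousOn_mourreG_Ici hM hz U
  exact continuousOn_const.inner
    (hG.clm_apply (continuousOn_const.clm_apply (hG.clm_apply continuousOn_const)))

/-- **FTC in `ε`** (ABG (7.3.12)): for `Im z < 0` and `ε₀ ≥ 0`,
`⟪f, R(z) f⟫ = ⟪f, G_{ε₀}(z) f⟫ - ∫₀^{ε₀} (-i ⟪f, G_ε(z) M G_ε(z) f⟫) dε`
(`G_0 = R(z)`, `d/dε ⟪f, G_ε f⟫ = -i⟪f, G_ε M G_ε f⟫`, everything continuous on `[0, ε₀]`).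
[cite: AmreinBoutetdeMonvelGeorgescu1996, Thm. 7.3.1 eq. (7.3.12)] -/
theorem inner_resolventAt_eq_inner_mourreG_sub_integral {M : H →L[ℂ] H}
    (hM : ∀ f : H, 0 ≤ (⟪f, M f⟫_ℂ).re) {z : ℂ} (hz : z.im < 0) (U : OneParameterUnitaryGroup H)
    (f : H) {ε₀ : ℝ} (hε₀ : 0 ≤ ε₀) :
    ⟪f, resolventAt U z f⟫_ℂ = ⟪f, mourreG U M ε₀ z f⟫_ℂ -
      ∫ ε in (0:ℝ)..ε₀, (-(I : ℂ) * ⟪f, mourreG U M ε z (M (mourreG U M ε z f))⟫_ℂ) := by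
  have hcont : ContinuousOn (fun ε : ℝ => ⟪f, mourreG U M ε z f⟫_ℂ) (Set.Icc 0 ε₀) :=
    (continuousOn_inner_mourreG_Ici hM hz U f f).mono Set.Icc_subset_Ici_self
  have hderiv : ∀ ε ∈ Set.Ioo 0 ε₀, HasDerivAt (fun ε : ℝ => ⟪f, mourreG U M ε z f⟫_ℂ)
      (-(I : ℂ) * ⟪f, mourreG U M ε z (M (mourreG U M ε z f))⟫_ℂ) ε := fun ε hε =>
    hasDerivAt_inner_mourreG hM hz.ne (mul_neg_of_pos_of_neg hε.1 hz) U f f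
  have hint : IntervalIntegrable
      (fun ε : ℝ => -(I : ℂ) * ⟪f, mourreG U M ε z (M (mourreG U M ε z f))⟫_ℂ) volume 0 ε₀ := by
    refine ContinuousOn.intervalIntegrable ?_
    rw [Set.uIcc_of_le hε₀]
    exact (continuousOn_const.mul (continuousOn_inner_mourreG_mul_mul_Ici hM hz U f f)).mono
      Set.Icc_subset_Ici_self
  have h := intervalIntegral.integral_eq_sub_of_hasDerivAt_of_le hε₀ hcont hderiv hint
  simp only [mourreG_zero] at h
  rw [h]
  ring

/-! ## §2. Lipschitz bounds in `z` at fixed `ε` -/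

omit [CompleteSpace H] in
/-- `‖⟪f, T g⟫‖ ≤ ‖T‖ ‖f‖ ‖g‖`. [folklore] -/
theorem norm_inner_clm_apply_le (T : H →L[ℂ] H) (f g : H) : ‖⟪f, T g⟫_ℂ‖ ≤ ‖T‖ * ‖f‖ * ‖g‖ :=
  calc ‖⟪f, T g⟫_ℂ‖ ≤ ‖f‖ * ‖T g‖ := norm_inner_le_norm f (T g)
    _ ≤ ‖f‖ * (‖T‖ * ‖g‖) := by gcongr; exact T.le_opNorm g
    _ = ‖T‖ * ‖f‖ * ‖g‖ := by ring

/-- **Lipschitz bound for `F_ε` in `z`**: `‖⟪f, G_ε(z₁) f⟫ - ⟪f, G_ε(z₂) f⟫‖ ≤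
‖z₁ - z₂‖ ‖G_ε(z₁)‖ ‖G_ε(z₂)‖ ‖f‖²` (first resolvent identity for `G`). [folklore] -/
theorem norm_inner_mourreG_sub_le {M : H →L[ℂ] H} (hM : ∀ f : H, 0 ≤ (⟪f, M f⟫_ℂ).re)
    {z₁ z₂ : ℂ} (hz₁ : z₁.im ≠ 0) (hz₂ : z₂.im ≠ 0) {ε : ℝ} (hε₁ : ε * z₁.im ≤ 0)
    (hε₂ : ε * z₂.im ≤ 0) (U : OneParameterUnitaryGroup H) (f : H) :
    ‖⟪f, mourreG U M ε z₁ f⟫_ℂ - ⟪f, mourreG U M ε z₂ f⟫_ℂ‖ ≤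
      ‖z₁ - z₂‖ * ‖mourreG U M ε z₁‖ * ‖mourreG U M ε z₂‖ * ‖f‖ ^ 2 := by
  rw [← inner_sub_right, ← sub_apply]
  refine (norm_inner_clm_apply_le _ f f).trans ?_
  have h : ‖mourreG U M ε z₁ - mourreG U M ε z₂‖ ≤
      ‖z₁ - z₂‖ * ‖mourreG U M ε z₁‖ * ‖mourreG U M ε z₂‖ := by
    rw [mourreG_sub_mourreG hM hz₁ hz₂ hε₁ hε₂ U, norm_smul, mul_assoc]
    gcongr
    exact norm_mul_le _ _
  calc ‖mourreG U M ε z₁ - mourreG U M ε z₂‖ * ‖f‖ * ‖f‖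
      ≤ ‖z₁ - z₂‖ * ‖mourreG U M ε z₁‖ * ‖mourreG U M ε z₂‖ * ‖f‖ * ‖f‖ := by gcongr
    _ = _ := by ring

omit [CompleteSpace H] in
/-- `G₁ M G₁ - G₂ M G₂ = (G₁ - G₂) M G₁ + G₂ M (G₁ - G₂)`. [folklore] -/
theorem mul_mul_sub_mul_mul (G₁ G₂ M : H →L[ℂ] H) :
    G₁ * M * G₁ - G₂ * M * G₂ = (G₁ - G₂) * M * G₁ + G₂ * M * (G₁ - G₂) := by
  simp only [sub_mul, mul_sub]
  abel

/-- **Lipschitz bound for `F'_ε` in `z`**: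
`‖⟪f, G₁ M G₁ f⟫ - ⟪f, G₂ M G₂ f⟫‖ ≤ ‖z₁ - z₂‖ ‖G₁‖ ‖G₂‖ ‖M‖ (‖G₁‖ + ‖G₂‖) ‖f‖²`
(`Gⱼ = G_ε(zⱼ)`). [folklore] -/
theorem norm_inner_mourreG_mul_mul_sub_le {M : H →L[ℂ] H} (hM : ∀ f : H, 0 ≤ (⟪f, M f⟫_ℂ).re)
    {z₁ z₂ : ℂ} (hz₁ : z₁.im ≠ 0) (hz₂ : z₂.im ≠ 0) {ε : ℝ} (hε₁ : ε * z₁.im ≤ 0)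
    (hε₂ : ε * z₂.im ≤ 0) (U : OneParameterUnitaryGroup H) (f : H) :
    ‖⟪f, mourreG U M ε z₁ (M (mourreG U M ε z₁ f))⟫_ℂ -
        ⟪f, mourreG U M ε z₂ (M (mourreG U M ε z₂ f))⟫_ℂ‖ ≤
      ‖z₁ - z₂‖ * ‖mourreG U M ε z₁‖ * ‖mourreG U M ε z₂‖ * ‖M‖ *
        (‖mourreG U M ε z₁‖ + ‖mourreG U M ε z₂‖) * ‖f‖ ^ 2 := by
  set G₁ := mourreG U M ε z₁ with hG₁
  set G₂ := mourreG U M ε z₂ with hG₂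
  have e : ⟪f, G₁ (M (G₁ f))⟫_ℂ - ⟪f, G₂ (M (G₂ f))⟫_ℂ = ⟪f, (G₁ * M * G₁ - G₂ * M * G₂) f⟫_ℂ := by
    rw [← inner_sub_right]; rfl
  rw [e]
  refine (norm_inner_clm_apply_le _ f f).trans ?_
  have hd : ‖G₁ - G₂‖ ≤ ‖z₁ - z₂‖ * ‖G₁‖ * ‖G₂‖ := by
    rw [hG₁, hG₂, mourreG_sub_mourreG hM hz₁ hz₂ hε₁ hε₂ U, norm_smul, mul_assoc]
    gcongr
    exact norm_mul_le _ _
  have h : ‖G₁ * M * G₁ - G₂ * M * G₂‖ ≤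
      ‖z₁ - z₂‖ * ‖G₁‖ * ‖G₂‖ * ‖M‖ * (‖G₁‖ + ‖G₂‖) := by
    rw [mul_mul_sub_mul_mul]
    calc ‖(G₁ - G₂) * M * G₁ + G₂ * M * (G₁ - G₂)‖
        ≤ ‖G₁ - G₂‖ * ‖M‖ * ‖G₁‖ + ‖G₂‖ * ‖M‖ * ‖G₁ - G₂‖ :=
          (norm_add_le _ _).trans (add_le_add norm_mul₃_le norm_mul₃_le)
      _ ≤ ‖z₁ - z₂‖ * ‖G₁‖ * ‖G₂‖ * ‖M‖ * ‖G₁‖ + ‖G₂‖ * ‖M‖ * (‖z₁ - z₂‖ * ‖G₁‖ * ‖G₂‖) := by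
          gcongr
      _ = _ := by ring
  calc ‖G₁ * M * G₁ - G₂ * M * G₂‖ * ‖f‖ * ‖f‖
      ≤ ‖z₁ - z₂‖ * ‖G₁‖ * ‖G₂‖ * ‖M‖ * (‖G₁‖ + ‖G₂‖) * ‖f‖ * ‖f‖ := by gcongr
    _ = _ := by ring

/-! ## §3. The uniform Cauchy property -/

/-- `Im (ω - iν) = -ν`, `‖(ω - iν₁) - (ω - iν₂)‖ = |ν₁ - ν₂|`. [folklore] -/
theorem im_ofReal_sub_I_mul (ω ν : ℝ) : ((ω : ℂ) - I * ν).im = -ν := by simp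

/-- `‖(ω - iν₁) - (ω - iν₂)‖ = |ν₁ - ν₂|`. [folklore] -/
theorem norm_ofReal_sub_I_mul_sub (ω ν₁ ν₂ : ℝ) :
    ‖((ω : ℂ) - I * ν₁) - ((ω : ℂ) - I * ν₂)‖ = |ν₁ - ν₂| := by
  have : ((ω : ℂ) - I * ν₁) - ((ω : ℂ) - I * ν₂) = -I * ((ν₁ - ν₂ : ℝ) : ℂ) := by
    push_cast; ring
  rw [this, norm_mul, norm_neg, Complex.norm_I, one_mul, Complex.norm_real, Real.norm_eq_abs]

/-- **Smallness of the head integral**: if `κ` is integrable on `(0, ε₀]`, `ε₀ > 0`, then for every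
`η > 0` there is `s ∈ (0, ε₀)` with `∫₀^s κ < η`. [folklore] -/
theorem exists_integral_head_lt {κ : ℝ → ℝ} {ε₀ : ℝ} (hε₀ : 0 < ε₀)
    (hκ : IntegrableOn κ (Set.Ioc 0 ε₀)) {η : ℝ} (hη : 0 < η) :
    ∃ s ∈ Set.Ioo 0 ε₀, ∫ τ in (0:ℝ)..s, κ τ < η := by
  have hii : IntervalIntegrable κ volume 0 ε₀ :=
    (intervalIntegrable_iff_integrableOn_Ioc_of_le hε₀.le).2 hκ
  have hc : ContinuousOn (fun b => ∫ τ in (0:ℝ)..b, κ τ) (Set.uIcc 0 ε₀) :=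
    intervalIntegral.continuousOn_primitive_interval' hii Set.left_mem_uIcc
  have h0 : Tendsto (fun b => ∫ τ in (0:ℝ)..b, κ τ) (𝓝[Set.uIcc 0 ε₀] 0) (𝓝 0) := by
    have := hc 0 Set.left_mem_uIcc
    simpa [ContinuousWithinAt, intervalIntegral.integral_same] using this
  have h1 : Tendsto (fun b => ∫ τ in (0:ℝ)..b, κ τ) (𝓝[>] 0) (𝓝 0) := by
    refine h0.mono_left ?_
    rw [Set.uIcc_of_le hε₀.le, ← nhdsWithin_Ioo_eq_nhdsGT hε₀]
    exact nhdsWithin_mono _ Set.Ioo_subset_Icc_self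
  have hev : ∀ᶠ b in 𝓝[>] (0:ℝ), (∫ τ in (0:ℝ)..b, κ τ) < η ∧ b ∈ Set.Ioo 0 ε₀ :=
    (h1.eventually (gt_mem_nhds hη)).and (Ioo_mem_nhdsGT hε₀)
  obtain ⟨s, hs, hs'⟩ := hev.exists
  exact ⟨s, hs', hs⟩

/-- **The uniform Cauchy property of `ν ↦ ⟪f, R(ω - iν) f⟫` from the `ε`-integration of Mourre's
differential inequality** (ABG (7.3.12)–(7.3.13), abstract form): let `M` be dissipative,
`ε₀ > 0`, and suppose that uniformly in `ω ∈ S`, `ν ∈ (0, 1]` one has `‖G_ε(ω - iν)‖ ≤ C/ε` for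
`ε ∈ (0, ε₀]` and `‖⟪f, G_ε M G_ε f⟫‖ ≤ κ(ε)` for `ε ∈ (0, ε₀)`, with `κ` integrable on
`(0, ε₀]`. Then for every `η > 0` there is `ν₀ > 0` such that
`‖⟪f, R(ω - iν₁) f⟫ - ⟪f, R(ω - iν₂) f⟫‖ < η` for all `ω ∈ S`, `ν₁, ν₂ ∈ (0, ν₀)`.
[cite: AmreinBoutetdeMonvelGeorgescu1996, Thm. 7.3.1 eqs. (7.3.12)–(7.3.13)] -/
theorem norm_inner_resolventAt_sub_lt_of_bounds (U : OneParameterUnitaryGroup H) {M : H →L[ℂ] H}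
    (hM : ∀ f : H, 0 ≤ (⟪f, M f⟫_ℂ).re) (f : H) {S : Set ℝ} {ε₀ C : ℝ} (hε₀ : 0 < ε₀)
    {κ : ℝ → ℝ} (hκi : IntegrableOn κ (Set.Ioc 0 ε₀))
    (hC : ∀ ω ∈ S, ∀ ν ∈ Set.Ioc (0:ℝ) 1, ∀ ε ∈ Set.Ioc 0 ε₀,
      ‖mourreG U M ε ((ω : ℂ) - I * ν)‖ ≤ C * ε⁻¹)
    (hκ : ∀ ω ∈ S, ∀ ν ∈ Set.Ioc (0:ℝ) 1, ∀ ε ∈ Set.Ioo 0 ε₀,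
      ‖⟪f, mourreG U M ε ((ω : ℂ) - I * ν) (M (mourreG U M ε ((ω : ℂ) - I * ν) f))⟫_ℂ‖ ≤ κ ε)
    {η : ℝ} (hη : 0 < η) :
    ∃ ν₀ > 0, ∀ ω ∈ S, ∀ ν₁ ∈ Set.Ioo (0:ℝ) ν₀, ∀ ν₂ ∈ Set.Ioo (0:ℝ) ν₀,
      ‖⟪f, resolventAt U ((ω : ℂ) - I * ν₁) f⟫_ℂ - ⟪f, resolventAt U ((ω : ℂ) - I * ν₂) f⟫_ℂ‖ < η := by
  -- the norm bound with a nonnegative constant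
  have hC' : ∀ ω ∈ S, ∀ ν ∈ Set.Ioc (0:ℝ) 1, ∀ ε ∈ Set.Ioc 0 ε₀,
      ‖mourreG U M ε ((ω : ℂ) - I * ν)‖ ≤ |C| * ε⁻¹ := fun ω hω ν hν ε hε =>
    (hC ω hω ν hν ε hε).trans (mul_le_mul_of_nonneg_right (le_abs_self C) (inv_nonneg.2 hε.1.le))
  -- the head: `s ∈ (0, ε₀)` with `∫₀^s (κ + κ) < η/2`
  have hκ2 : IntegrableOn (fun τ => κ τ + κ τ) (Set.Ioc 0 ε₀) := hκi.add hκi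
  obtain ⟨s, hs, hhead⟩ := exists_integral_head_lt hε₀ hκ2 (half_pos hη)
  -- the Lipschitz constant of the boundary term and of the tail
  set L : ℝ := ‖f‖ ^ 2 * (|C| * ε₀⁻¹) ^ 2 +
    ε₀ * ((|C| * s⁻¹) ^ 2 * ‖M‖ * (2 * (|C| * s⁻¹)) * ‖f‖ ^ 2) with hL
  have hs0 : 0 < s := hs.1
  have hL0 : 0 ≤ L := by positivity
  refine ⟨min 1 (η / (2 * (L + 1))), lt_min one_pos (by positivity), ?_⟩
  intro ω hω ν₁ hν₁ ν₂ hν₂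
  have hν₀1 : min 1 (η / (2 * (L + 1))) ≤ 1 := min_le_left _ _
  have hν₀2 : min 1 (η / (2 * (L + 1))) ≤ η / (2 * (L + 1)) := min_le_right _ _
  have hν₁' : ν₁ ∈ Set.Ioc (0:ℝ) 1 := ⟨hν₁.1, hν₁.2.le.trans hν₀1⟩
  have hν₂' : ν₂ ∈ Set.Ioc (0:ℝ) 1 := ⟨hν₂.1, hν₂.2.le.trans hν₀1⟩
  have hd : |ν₁ - ν₂| ≤ η / (2 * (L + 1)) :=
    (abs_sub_lt_iff.2 ⟨by linarith [hν₁.2, hν₂.1], by linarith [hν₂.2, hν₁.1]⟩).le.trans hν₀2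
  set z₁ : ℂ := (ω : ℂ) - I * ν₁ with hz₁def
  set z₂ : ℂ := (ω : ℂ) - I * ν₂ with hz₂def
  have hz₁ : z₁.im < 0 := by rw [hz₁def, im_ofReal_sub_I_mul]; exact neg_neg_of_pos hν₁.1
  have hz₂ : z₂.im < 0 := by rw [hz₂def, im_ofReal_sub_I_mul]; exact neg_neg_of_pos hν₂.1
  have hz12 : ‖z₁ - z₂‖ = |ν₁ - ν₂| := norm_ofReal_sub_I_mul_sub ω ν₁ ν₂
  have hεz₁ : ∀ {ε : ℝ}, 0 ≤ ε → ε * z₁.im ≤ 0 := fun hε => mul_nonpos_of_nonneg_of_nonpos hε hz₁.le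
  have hεz₂ : ∀ {ε : ℝ}, 0 ≤ ε → ε * z₂.im ≤ 0 := fun hε => mul_nonpos_of_nonneg_of_nonpos hε hz₂.le
  -- the two derivative functions
  set F'₁ : ℝ → ℂ := fun ε => -(I : ℂ) * ⟪f, mourreG U M ε z₁ (M (mourreG U M ε z₁ f))⟫_ℂ
    with hF'₁
  set F'₂ : ℝ → ℂ := fun ε => -(I : ℂ) * ⟪f, mourreG U M ε z₂ (M (mourreG U M ε z₂ f))⟫_ℂ
    with hF'₂
  have hc₁ : ContinuousOn F'₁ (Set.Icc 0 ε₀) :=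
    (continuousOn_const.mul (continuousOn_inner_mourreG_mul_mul_Ici hM hz₁ U f f)).mono
      Set.Icc_subset_Ici_self
  have hc₂ : ContinuousOn F'₂ (Set.Icc 0 ε₀) :=
    (continuousOn_const.mul (continuousOn_inner_mourreG_mul_mul_Ici hM hz₂ U f f)).mono
      Set.Icc_subset_Ici_self
  have hint : ∀ {a b : ℝ}, 0 ≤ a → a ≤ b → b ≤ ε₀ →
      IntervalIntegrable (fun ε => F'₁ ε - F'₂ ε) volume a b := by
    intro a b ha hab hb
    refine ContinuousOn.intervalIntegrable ?_
    rw [Set.uIcc_of_le hab]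
    exact (hc₁.sub hc₂).mono (Set.Icc_subset_Icc ha hb)
  have hR₁ := inner_resolventAt_eq_inner_mourreG_sub_integral hM hz₁ U f hε₀.le
  have hR₂ := inner_resolventAt_eq_inner_mourreG_sub_integral hM hz₂ U f hε₀.le
  -- the difference, split at `s`
  have hdiff : ⟪f, resolventAt U z₁ f⟫_ℂ - ⟪f, resolventAt U z₂ f⟫_ℂ =
      (⟪f, mourreG U M ε₀ z₁ f⟫_ℂ - ⟪f, mourreG U M ε₀ z₂ f⟫_ℂ) -
        ((∫ ε in (0:ℝ)..s, (F'₁ ε - F'₂ ε)) + ∫ ε in s..ε₀, (F'₁ ε - F'₂ ε)) := by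
    rw [intervalIntegral.integral_add_adjacent_intervals (hint le_rfl hs.1.le hs.2.le)
        (hint hs.1.le hs.2.le le_rfl),
      intervalIntegral.integral_sub (hc₁.intervalIntegrable_of_Icc hε₀.le)
        (hc₂.intervalIntegrable_of_Icc hε₀.le), hR₁, hR₂]
    ring
  -- (i) the boundary term
  have hb1 : ‖⟪f, mourreG U M ε₀ z₁ f⟫_ℂ - ⟪f, mourreG U M ε₀ z₂ f⟫_ℂ‖ ≤
      |ν₁ - ν₂| * (‖f‖ ^ 2 * (|C| * ε₀⁻¹) ^ 2) := by
    refine (norm_inner_mourreG_sub_le hM hz₁.ne hz₂.ne (hεz₁ hε₀.le) (hεz₂ hε₀.le) U f).trans ?_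
    rw [hz12]
    have h1 : ‖mourreG U M ε₀ z₁‖ ≤ |C| * ε₀⁻¹ := hC' ω hω ν₁ hν₁' ε₀ ⟨hε₀, le_rfl⟩
    have h2 : ‖mourreG U M ε₀ z₂‖ ≤ |C| * ε₀⁻¹ := hC' ω hω ν₂ hν₂' ε₀ ⟨hε₀, le_rfl⟩
    calc |ν₁ - ν₂| * ‖mourreG U M ε₀ z₁‖ * ‖mourreG U M ε₀ z₂‖ * ‖f‖ ^ 2
        ≤ |ν₁ - ν₂| * (|C| * ε₀⁻¹) * (|C| * ε₀⁻¹) * ‖f‖ ^ 2 := by gcongr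
      _ = _ := by ring
  -- (ii) the head
  have hb2 : ‖∫ ε in (0:ℝ)..s, (F'₁ ε - F'₂ ε)‖ < η / 2 := by
    refine lt_of_le_of_lt ?_ hhead
    refine intervalIntegral.norm_integral_le_of_norm_le hs.1.le (ae_of_all _ fun t ht => ?_) ?_
    · have ht' : t ∈ Set.Ioo 0 ε₀ := ⟨ht.1, ht.2.trans_lt hs.2⟩
      have e1 : ‖F'₁ t‖ = ‖⟪f, mourreG U M t z₁ (M (mourreG U M t z₁ f))⟫_ℂ‖ := by
        simp only [hF'₁, norm_mul, norm_neg, Complex.norm_I, one_mul]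
      have e2 : ‖F'₂ t‖ = ‖⟪f, mourreG U M t z₂ (M (mourreG U M t z₂ f))⟫_ℂ‖ := by
        simp only [hF'₂, norm_mul, norm_neg, Complex.norm_I, one_mul]
      calc ‖F'₁ t - F'₂ t‖ ≤ ‖F'₁ t‖ + ‖F'₂ t‖ := norm_sub_le _ _
        _ ≤ κ t + κ t :=
          add_le_add (e1 ▸ hκ ω hω ν₁ hν₁' t ht') (e2 ▸ hκ ω hω ν₂ hν₂' t ht')
    · exact (intervalIntegrable_iff_integrableOn_Ioc_of_le hs.1.le).2
        (hκ2.mono_set (Set.Ioc_subset_Ioc_right hs.2.le))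
  -- (iii) the tail
  have hb3 : ‖∫ ε in s..ε₀, (F'₁ ε - F'₂ ε)‖ ≤
      |ν₁ - ν₂| * (ε₀ * ((|C| * s⁻¹) ^ 2 * ‖M‖ * (2 * (|C| * s⁻¹)) * ‖f‖ ^ 2)) := by
    have key : ∀ t ∈ Set.uIoc s ε₀, ‖F'₁ t - F'₂ t‖ ≤
        |ν₁ - ν₂| * ((|C| * s⁻¹) ^ 2 * ‖M‖ * (2 * (|C| * s⁻¹)) * ‖f‖ ^ 2) := by
      intro t ht
      rw [Set.uIoc_of_le hs.2.le] at ht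
      have ht0 : 0 < t := hs0.trans ht.1
      have hts : t⁻¹ ≤ s⁻¹ := inv_anti₀ hs0 ht.1.le
      have hG₁ : ‖mourreG U M t z₁‖ ≤ |C| * s⁻¹ :=
        (hC' ω hω ν₁ hν₁' t ⟨ht0, ht.2⟩).trans (by gcongr)
      have hG₂ : ‖mourreG U M t z₂‖ ≤ |C| * s⁻¹ :=
        (hC' ω hω ν₂ hν₂' t ⟨ht0, ht.2⟩).trans (by gcongr)
      have e : ‖F'₁ t - F'₂ t‖ = ‖⟪f, mourreG U M t z₁ (M (mourreG U M t z₁ f))⟫_ℂ -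
          ⟪f, mourreG U M t z₂ (M (mourreG U M t z₂ f))⟫_ℂ‖ := by
        simp only [hF'₁, hF'₂, ← mul_sub, norm_mul, norm_neg, Complex.norm_I, one_mul]
      rw [e]
      refine (norm_inner_mourreG_mul_mul_sub_le hM hz₁.ne hz₂.ne (hεz₁ ht0.le) (hεz₂ ht0.le)
        U f).trans ?_
      rw [hz12]
      calc |ν₁ - ν₂| * ‖mourreG U M t z₁‖ * ‖mourreG U M t z₂‖ * ‖M‖ *
            (‖mourreG U M t z₁‖ + ‖mourreG U M t z₂‖) * ‖f‖ ^ 2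
          ≤ |ν₁ - ν₂| * (|C| * s⁻¹) * (|C| * s⁻¹) * ‖M‖ * (|C| * s⁻¹ + |C| * s⁻¹) * ‖f‖ ^ 2 := by
            gcongr
        _ = _ := by ring
    calc ‖∫ ε in s..ε₀, (F'₁ ε - F'₂ ε)‖
        ≤ |ν₁ - ν₂| * ((|C| * s⁻¹) ^ 2 * ‖M‖ * (2 * (|C| * s⁻¹)) * ‖f‖ ^ 2) * |ε₀ - s| :=
          intervalIntegral.norm_integral_le_of_norm_le_const key
      _ ≤ |ν₁ - ν₂| * ((|C| * s⁻¹) ^ 2 * ‖M‖ * (2 * (|C| * s⁻¹)) * ‖f‖ ^ 2) * ε₀ := by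
          gcongr
          rw [abs_of_nonneg (by linarith [hs.2])]
          linarith [hs.1]
      _ = _ := by ring
  -- assembly
  have hsum : ‖⟪f, mourreG U M ε₀ z₁ f⟫_ℂ - ⟪f, mourreG U M ε₀ z₂ f⟫_ℂ‖ +
      ‖∫ ε in s..ε₀, (F'₁ ε - F'₂ ε)‖ ≤ η / 2 := by
    have e : |ν₁ - ν₂| * L = |ν₁ - ν₂| * (‖f‖ ^ 2 * (|C| * ε₀⁻¹) ^ 2) +
        |ν₁ - ν₂| * (ε₀ * ((|C| * s⁻¹) ^ 2 * ‖M‖ * (2 * (|C| * s⁻¹)) * ‖f‖ ^ 2)) := by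
      rw [hL]; ring
    have h2 : |ν₁ - ν₂| * L ≤ η / 2 :=
      calc |ν₁ - ν₂| * L ≤ |ν₁ - ν₂| * (L + 1) := by gcongr; linarith
        _ ≤ η / (2 * (L + 1)) * (L + 1) := by gcongr
        _ = η / 2 := by field_simp
    linarith [hb1, hb3, e, h2]
  rw [hdiff]
  calc ‖⟪f, mourreG U M ε₀ z₁ f⟫_ℂ - ⟪f, mourreG U M ε₀ z₂ f⟫_ℂ -
        ((∫ ε in (0:ℝ)..s, (F'₁ ε - F'₂ ε)) + ∫ ε in s..ε₀, (F'₁ ε - F'₂ ε))‖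
      ≤ ‖⟪f, mourreG U M ε₀ z₁ f⟫_ℂ - ⟪f, mourreG U M ε₀ z₂ f⟫_ℂ‖ +
          (‖∫ ε in (0:ℝ)..s, (F'₁ ε - F'₂ ε)‖ + ‖∫ ε in s..ε₀, (F'₁ ε - F'₂ ε)‖) :=
        (norm_sub_le _ _).trans (add_le_add le_rfl (norm_add_le _ _))
    _ < η := by linarith [hsum, hb2]

/-- **Uniform Cauchy property of the Laplace–Fourier transform, headline form** (all binders
explicit; registered helper stub of `stub_mourreThresholdLAP`, S6-PLAN F5): under the abstract
output of Mourre's differential inequality — a dissipative bounded `M`, `ε₀ > 0`, a norm bound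
`‖G_ε(ω - iν)‖ ≤ C/ε` on `(0, ε₀]` and a derivative bound `‖⟪f, G_ε M G_ε f⟫‖ ≤ κ(ε)` on
`(0, ε₀)` with `κ` integrable on `(0, ε₀]`, both uniform in `ω ∈ S`, `ν ∈ (0, 1]` — the
transforms `ν ↦ (ω ↦ ∫₀^∞ e^{-νt} e^{-iωt} ⟪f, U_t f⟫ dt) = i⟪f, R(ω - iν) f⟫` are uniformly
Cauchy on `S` as `ν ↓ 0`. [cite: AmreinBoutetdeMonvelGeorgescu1996, Thm. 7.3.1 eqs. (7.3.12)–(7.3.13)] -/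
theorem laplaceFourier_uniformCauchy_of_bounds :
    ∀ (K : Type) [NormedAddCommGroup K] [InnerProductSpace ℂ K] [CompleteSpace K]
      (U : Literature.Analysis.UnboundedOperators.OneParameterUnitaryGroup K) (M : K →L[ℂ] K)
      (f : K) (S : Set ℝ) (ε₀ C : ℝ) (κ : ℝ → ℝ),
      (∀ g : K, 0 ≤ (inner ℂ g (M g)).re) → 0 < ε₀ →
      MeasureTheory.IntegrableOn κ (Set.Ioc 0 ε₀) MeasureTheory.volume →
      (∀ ω ∈ S, ∀ ν ∈ Set.Ioc (0:ℝ) 1, ∀ ε ∈ Set.Ioc 0 ε₀,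
        ‖Summit.AtomisticToContinuum.FouriersLaw.Theorems.MourreDissolution.mourreG U M ε
            ((ω : ℂ) - Complex.I * (ν : ℂ))‖ ≤ C * ε⁻¹) →
      (∀ ω ∈ S, ∀ ν ∈ Set.Ioc (0:ℝ) 1, ∀ ε ∈ Set.Ioo 0 ε₀,
        ‖inner ℂ f
            (Summit.AtomisticToContinuum.FouriersLaw.Theorems.MourreDissolution.mourreG U M ε
              ((ω : ℂ) - Complex.I * (ν : ℂ))
              (M (Summit.AtomisticToContinuum.FouriersLaw.Theorems.MourreDissolution.mourreG U M ε
                ((ω : ℂ) - Complex.I * (ν : ℂ)) f)))‖ ≤ κ ε) →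
      UniformCauchySeqOn
        (fun (ν : ℝ) (ω : ℝ) =>
          Summit.AtomisticToContinuum.FouriersLaw.Theorems.MourreDissolution.laplaceFourier U f ν ω)
        (nhdsWithin (0:ℝ) (Set.Ioi 0)) S := by
  intro K _ _ _ U M f S ε₀ C κ hM hε₀ hκi hC hκ u hu
  obtain ⟨η, hη, hηu⟩ := Metric.mem_uniformity_dist.1 hu
  obtain ⟨ν₀, hν₀, h⟩ := norm_inner_resolventAt_sub_lt_of_bounds U hM f hε₀ hκi hC hκ hη
  have hmem : Set.Ioo (0:ℝ) ν₀ ∈ 𝓝[>] (0:ℝ) := Ioo_mem_nhdsGT hν₀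
  filter_upwards [Filter.prod_mem_prod hmem hmem] with p hp ω hω
  refine hηu ?_
  rw [dist_eq_norm, laplaceFourier_eq_inner_resolventAt U f hp.1.1 ω,
    laplaceFourier_eq_inner_resolventAt U f hp.2.1 ω, ← mul_sub, norm_mul, Complex.norm_I, one_mul]
  exact h ω hω p.1 hp.1 p.2 hp.2

end Summit.AtomisticToContinuum.FouriersLaw.Theorems.MourreDissolution
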